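import Mathlib

/-!
# One integer matrix cuts out the bad locus of the Marica–Schönheim pencil in EVERY characteristic

Helper file for crux `stmt-CriticalPhenomena-4575` (`NoHeavyLowerTail`, route `PercNearOneGluingNoHeavy`),
new-inequality factory seat `prim-ineq-gen-3` (gen 24).  Everything here is PROVED; no definitions.

Gen 20 (`OrderedDifferences.linearIndependent_pencil_diffs`) proved the pencil theorem for RATIONAL `t` by showing that a dependency
`c` of the rows `A ↦ (E ↦ [E ⊆ A] + t [E ∩ A = ∅])` is a left eigenvector, with eigenvalue `-t`, of an INTEGER matrix.  Gen 24 found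
that the statement fails over finite fields (Fano plane over `ZMod 7`, `…OrderedDifferencesFano`), and explained all counterexamples by the
structure of the integer cokernel (memo `FINDINGS-gen24.md` F24-2).  This file records the characteristic-free core of that structure in
the tree:

* `exists_intMatrix_vecMul_eq_smul` — for every finite family `𝒜` there is ONE integer matrix `G` (indexed by `𝒜`; explicitly
  `G = M · L⁻ᵀ` with `L = ([A ⊆ B])`, `M = (κ(A ∩ B))`, `κ` the Möbius sums of `𝒜 \\ 𝒜`) such that over EVERY field `K` and for every
  `t ∈ K`, every dependency `c` of the pencil rows at `t` satisfies `c · G = -t · c`.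
* `exists_monic_aeval_eq_zero_of_dependent` — hence one monic integer polynomial `p` of degree `#𝒜` (the characteristic polynomial of `G`)
  with: whenever the pencil rows of `𝒜` are linearly dependent over a field `K` at `t`, then `p(-t) = 0` in `K`.  So in each
  characteristic the bad `t` are among the `#𝒜` roots of `p`; in characteristic `0` they are algebraic integers (and, dually, units);
  `p(-3) ≡ 0 (mod 7)` for the Fano plane.
(prim-ineq-gen-3 gen 24, 2026-08-24.)
-/

namespace Summit.CriticalPhenomena.PercolationContinuityZ3.Theorems

namespace OrderedDifferences

open Finset Matrix Polynomial
open scoped FinsetFamily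

universe u

variable {α : Type*} [DecidableEq α]

/-- Integer Möbius weights (local copy of `exists_moebius_weights_int`). -/
private theorem moebius_weights_int' (T : Finset (Finset α)) :
    ∃ μ : Finset α → ℤ, ∀ Z ∈ T, ∑ E ∈ T.filter (· ⊆ Z), μ E = if Z = ∅ then 1 else 0 := by
  let H : (s : Finset α) → ((t : Finset α) → t ⊂ s → ℤ) → ℤ := fun s ih =>
    (if s = ∅ then (1 : ℤ) else 0) - ∑ t ∈ (T.filter (· ⊂ s)).attach, ih t.1 (mem_filter.mp t.2).2
  let μ : Finset α → ℤ := Finset.strongInduction H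
  have hμ : ∀ s, μ s = (if s = ∅ then (1 : ℤ) else 0) - ∑ t ∈ T.filter (· ⊂ s), μ t := by
    intro s
    have e : μ s = H s (fun t _ => μ t) := Finset.strongInduction_eq H s
    rw [e]
    show (if s = ∅ then (1 : ℤ) else 0) - ∑ t ∈ (T.filter (· ⊂ s)).attach, μ t.1 = _
    rw [sum_attach (T.filter (· ⊂ s)) (fun t => μ t)]
  refine ⟨μ, fun Z hZ => ?_⟩
  have hsplit : T.filter (· ⊆ Z) = insert Z (T.filter (· ⊂ Z)) := by
    ext E
    simp only [mem_filter, mem_insert]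
    refine ⟨fun ⟨hE, hEZ⟩ => (lt_or_eq_of_le hEZ).elim (fun h => Or.inr ⟨hE, h⟩) Or.inl, ?_⟩
    rintro (rfl | ⟨hE, hEZ⟩)
    · exact ⟨hZ, subset_rfl⟩
    · exact ⟨hE, hEZ.le⟩
  have hnot : Z ∉ T.filter (· ⊂ Z) := fun h => lt_irrefl Z (mem_filter.mp h).2
  rw [hsplit, sum_insert hnot, hμ]
  abel

/-- The containment matrix of a family has determinant `1` (local copy of `det_subsetMatrix_eq_one`). -/
private theorem det_subsetMatrix_eq_one' (𝒜 : Finset (Finset α)) :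
    (Matrix.of fun (A B : 𝒜) => if (A : Finset α) ⊆ (B : Finset α) then (1 : ℤ) else 0).det = 1 := by
  classical
  let L : Matrix 𝒜 𝒜 ℤ := Matrix.of fun (A B : 𝒜) => if (A : Finset α) ⊆ (B : Finset α) then (1 : ℤ) else 0
  have hLap : ∀ A B : 𝒜, L A B = if (A : Finset α) ⊆ (B : Finset α) then (1 : ℤ) else 0 := fun A B => rfl
  show L.det = 1
  have hBT : L.BlockTriangular (fun A : 𝒜 => #(A : Finset α)) := by
    intro A B hAB
    have hlt : #(B : Finset α) < #(A : Finset α) := hAB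
    have hns : ¬ (A : Finset α) ⊆ (B : Finset α) := fun h => absurd (card_le_card h) (not_le.mpr hlt)
    rw [hLap, if_neg hns]
  rw [hBT.det]
  refine prod_eq_one fun k _ => ?_
  have hblock : L.toSquareBlock (fun A : 𝒜 => #(A : Finset α)) k = 1 := by
    ext ⟨A, hA⟩ ⟨B, hB⟩
    rw [toSquareBlock_def, of_apply]
    by_cases h : A = B
    · subst h
      rw [one_apply_eq, hLap, if_pos subset_rfl]
    · have hcard : #(A : Finset α) = #(B : Finset α) := by
        have h1 : #(A : Finset α) = k := hA
        have h2 : #(B : Finset α) = k := hB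
        exact h1.trans h2.symm
      have hns : ¬ (A : Finset α) ⊆ (B : Finset α) := fun hs =>
        h (Subtype.ext (eq_of_subset_of_card_le hs hcard.ge))
      rw [one_apply_ne (fun h' => h (Subtype.ext_iff.mp h')), hLap, if_neg hns]
  rw [hblock, det_one]

/-- **One integer matrix for all characteristics.**  For every finite family `𝒜` there is an integer matrix `G` on `𝒜` such that,
over every field `K` and for every `t ∈ K`, every linear dependency `c` of the pencil rows
`A ↦ (E ↦ [E ⊆ A] + t [E ∩ A = ∅])` (`E ∈ 𝒜 \\ 𝒜`) is a left eigenvector of `G` with eigenvalue `-t`:  `c · G = -t · c`.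
(`G = M L⁻ᵀ` with `L = ([A ⊆ B])` unimodular and `M A B = ∑_{E ∈ 𝒜 \\ 𝒜, E ⊆ A ∩ B} μ E`, `μ` the integer Möbius weights.) -/
theorem exists_intMatrix_vecMul_eq_smul (𝒜 : Finset (Finset α)) :
    ∃ G : Matrix 𝒜 𝒜 ℤ, ∀ (K : Type u) [Field K] (t : K) (c : ↥𝒜 → K),
      (∑ A : 𝒜, c A • (fun E : (𝒜 \\ 𝒜 : Finset (Finset α)) =>
        (if (E : Finset α) ⊆ (A : Finset α) then (1 : K) else 0) +
          t * (if Disjoint (E : Finset α) (A : Finset α) then (1 : K) else 0))) = 0 →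
      c ᵥ* G.map (Int.castRingHom K) = (-t) • c := by
  classical
  set T : Finset (Finset α) := 𝒜 \\ 𝒜 with hTdef
  have hT : ∀ A ∈ 𝒜, ∀ B ∈ 𝒜, A \ B ∈ T := fun A hA B hB => mem_diffs.mpr ⟨A, hA, B, hB, rfl⟩
  obtain ⟨μ, hμ⟩ := moebius_weights_int' T
  let κ : Finset α → ℤ := fun Y => ∑ E ∈ T.filter (· ⊆ Y), μ E
  have hκ : ∀ A ∈ 𝒜, ∀ B ∈ 𝒜, κ (A \ B) = if A ⊆ B then 1 else 0 := by
    intro A hA B hB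
    show ∑ E ∈ T.filter (· ⊆ A \ B), μ E = _
    rw [hμ _ (hT A hA B hB)]
    simp [sdiff_eq_empty_iff_subset]
  let L : Matrix 𝒜 𝒜 ℤ := Matrix.of fun A B => if (A : Finset α) ⊆ (B : Finset α) then (1 : ℤ) else 0
  let M : Matrix 𝒜 𝒜 ℤ := Matrix.of fun A B => κ ((A : Finset α) ∩ (B : Finset α))
  have hLap : ∀ A B : 𝒜, L A B = if (A : Finset α) ⊆ (B : Finset α) then (1 : ℤ) else 0 := fun A B => rfl
  have hMap : ∀ A B : 𝒜, M A B = κ ((A : Finset α) ∩ (B : Finset α)) := fun A B => rfl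
  have hdetL : L.det = 1 := det_subsetMatrix_eq_one' 𝒜
  have hULT : IsUnit L.transpose.det := by rw [det_transpose, hdetL]; exact isUnit_one
  refine ⟨M * (L.transpose)⁻¹, ?_⟩
  intro K _ t c hc
  let f : ℤ →+* K := Int.castRingHom K
  -- pointwise form of the dependency
  have hdep : ∀ E : T, ∑ A : 𝒜, c A * ((if (E : Finset α) ⊆ (A : Finset α) then (1 : K) else 0) +
      t * (if Disjoint (E : Finset α) (A : Finset α) then (1 : K) else 0)) = 0 := by
    intro E
    have := congr_fun hc E
    simpa [Finset.sum_apply, Pi.smul_apply, smul_eq_mul] using this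
  have hfilt : ∀ (p : Finset α → Prop) [DecidablePred p] (g : Finset α → K),
      ∑ E ∈ T.filter p, g E = ∑ E : T, if p E then g E else 0 := by
    intro p _ g
    rw [sum_filter, ← Finset.sum_coe_sort T]
  -- testing the dependency against an integer vector `w`
  have htest : ∀ w : Finset α → ℤ,
      ∑ A : 𝒜, c A * ((∑ E ∈ T.filter (· ⊆ (A : Finset α)), ((μ E * w E : ℤ) : K)) +
        t * ∑ E ∈ T.filter (fun E => Disjoint E (A : Finset α)), ((μ E * w E : ℤ) : K)) = 0 := by
    intro w
    have hA : ∀ A : 𝒜, (∑ E ∈ T.filter (· ⊆ (A : Finset α)), ((μ E * w E : ℤ) : K)) +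
        t * ∑ E ∈ T.filter (fun E => Disjoint E (A : Finset α)), ((μ E * w E : ℤ) : K) =
        ∑ E : T, ((μ E * w E : ℤ) : K) * ((if (E : Finset α) ⊆ (A : Finset α) then (1 : K) else 0) +
          t * (if Disjoint (E : Finset α) (A : Finset α) then (1 : K) else 0)) := by
      intro A
      rw [hfilt, hfilt, mul_sum, ← sum_add_distrib]
      refine sum_congr rfl fun E _ => ?_
      by_cases h1 : (E : Finset α) ⊆ (A : Finset α) <;>
        by_cases h2 : Disjoint (E : Finset α) (A : Finset α) <;> simp [h1, h2] <;> ring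
    simp_rw [hA, mul_sum]
    rw [sum_comm]
    refine sum_eq_zero fun E _ => ?_
    have h3 : ∑ A : 𝒜, c A * (((μ E * w E : ℤ) : K) * ((if (E : Finset α) ⊆ (A : Finset α) then (1 : K) else 0) +
        t * (if Disjoint (E : Finset α) (A : Finset α) then (1 : K) else 0))) =
        ((μ E * w E : ℤ) : K) * ∑ A : 𝒜, c A * ((if (E : Finset α) ⊆ (A : Finset α) then (1 : K) else 0) +
          t * (if Disjoint (E : Finset α) (A : Finset α) then (1 : K) else 0)) := by
      rw [mul_sum]
      refine sum_congr rfl fun A _ => ?_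
      ring
    rw [h3, hdep E, mul_zero]
  -- the two entry identities for the test vector `[E ⊆ B]`
  have eM : ∀ A B : 𝒜, ∑ E ∈ T.filter (· ⊆ (A : Finset α)),
      ((μ E * (if E ⊆ (B : Finset α) then (1 : ℤ) else 0) : ℤ) : K) = ((M A B : ℤ) : K) := by
    intro A B
    rw [hMap]
    show _ = ((∑ E ∈ T.filter (· ⊆ (A : Finset α) ∩ (B : Finset α)), μ E : ℤ) : K)
    push_cast
    rw [sum_filter, sum_filter]
    refine sum_congr rfl fun E _ => ?_
    by_cases h1 : E ⊆ (A : Finset α) <;> by_cases h2 : E ⊆ (B : Finset α) <;>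
      simp [h1, h2, subset_inter_iff]
  have eLt : ∀ A B : 𝒜, ∑ E ∈ T.filter (fun E => Disjoint E (A : Finset α)),
      ((μ E * (if E ⊆ (B : Finset α) then (1 : ℤ) else 0) : ℤ) : K) = ((L B A : ℤ) : K) := by
    intro A B
    rw [hLap, ← hκ _ B.2 _ A.2]
    show _ = ((∑ E ∈ T.filter (· ⊆ (B : Finset α) \ (A : Finset α)), μ E : ℤ) : K)
    push_cast
    rw [sum_filter, sum_filter]
    refine sum_congr rfl fun E _ => ?_
    by_cases h1 : Disjoint E (A : Finset α) <;> by_cases h2 : E ⊆ (B : Finset α) <;>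
      simp [h1, h2, subset_sdiff]
  -- testing against `[E ⊆ B]`:  c (M + t Lᵀ) = 0
  have eq2 : ∀ B : 𝒜, ∑ A : 𝒜, c A * (((M A B : ℤ) : K) + t * ((L B A : ℤ) : K)) = 0 := by
    intro B
    have h := htest (fun E => if E ⊆ (B : Finset α) then 1 else 0)
    rw [← h]
    refine sum_congr rfl fun A _ => ?_
    rw [eM A B, eLt A B]
  have eq2m : c ᵥ* M.map f = -t • (c ᵥ* (L.transpose).map f) := by
    ext B
    have h := eq2 B
    simp only [Matrix.vecMul, dotProduct, Matrix.map_apply, Matrix.transpose_apply, Pi.smul_apply,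
      smul_eq_mul, f, eq_intCast] at h ⊢
    have h' : ∑ A, c A * ((M A B : ℤ) : K) + t * ∑ A, c A * ((L B A : ℤ) : K) = 0 := by
      rw [mul_sum, ← sum_add_distrib, ← h]
      refine sum_congr rfl fun A _ => ?_
      ring
    linear_combination h'
  -- `c · (M L⁻ᵀ) = -t · c`
  rw [Matrix.map_mul, ← Matrix.vecMul_vecMul, eq2m, Matrix.smul_vecMul, Matrix.vecMul_vecMul,
    ← Matrix.map_mul, Matrix.mul_nonsing_inv _ hULT]
  simp

/-- **A single monic integer polynomial containing the bad locus in every characteristic.**  For every finite family `𝒜` there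
is a monic `p ∈ ℤ[X]` of degree `#𝒜` such that for every field `K` and every `t ∈ K`: if the pencil rows
`A ↦ (E ↦ [E ⊆ A] + t [E ∩ A = ∅])` over `𝒜 \\ 𝒜` are linearly dependent over `K`, then `p(-t) = 0` in `K`.  In particular in each
characteristic only finitely many `t` are bad, and in characteristic `0` every bad `t` is an algebraic integer. -/
theorem exists_monic_aeval_eq_zero_of_dependent (𝒜 : Finset (Finset α)) :
    ∃ p : ℤ[X], p.Monic ∧ p.natDegree = #𝒜 ∧ ∀ (K : Type u) [Field K] (t : K),
      ¬ LinearIndependent K (fun A : 𝒜 => fun E : (𝒜 \\ 𝒜 : Finset (Finset α)) =>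
        (if (E : Finset α) ⊆ (A : Finset α) then (1 : K) else 0) +
          t * (if Disjoint (E : Finset α) (A : Finset α) then (1 : K) else 0)) →
      (p.map (Int.castRingHom K)).eval (-t) = 0 := by
  classical
  obtain ⟨G, hG⟩ := exists_intMatrix_vecMul_eq_smul 𝒜
  refine ⟨G.charpoly, charpoly_monic G, ?_, ?_⟩
  · rw [charpoly_natDegree_eq_dim, Fintype.card_coe]
  · intro K _ t hli
    rw [Fintype.not_linearIndependent_iff] at hli
    obtain ⟨c, hc, i, hi⟩ := hli
    have hc0 : c ≠ 0 := fun h => hi (by rw [h]; rfl)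
    have hev := hG K t c hc
    set G' : Matrix 𝒜 𝒜 K := G.map (Int.castRingHom K) with hG'
    have hsc : c ᵥ* Matrix.scalar (↥𝒜) (-t) = (-t) • c := by
      ext j
      simp [Matrix.scalar_apply, Matrix.vecMul_diagonal, mul_comm]
    have hker : c ᵥ* (Matrix.scalar (↥𝒜) (-t) - G') = 0 := by
      rw [Matrix.vecMul_sub, hev, hsc, sub_self]
    have hdet : (Matrix.scalar (↥𝒜) (-t) - G').det = 0 :=
      (Matrix.exists_vecMul_eq_zero_iff).mp ⟨c, hc0, hker⟩
    have hmap : G'.charpoly = G.charpoly.map (Int.castRingHom K) := by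
      rw [hG']
      exact Matrix.charpoly_map G (Int.castRingHom K)
    rw [← hmap, Matrix.eval_charpoly]
    exact hdet

/-- **Both ends: `t` and `t⁻¹`.**  For every finite family `𝒜` there are TWO integer matrices `G, H` on `𝒜` such that over every
field `K`, for every `t ∈ K` and every dependency `c` of the pencil rows at `t`:  `c · G = -t · c` and `t · (c · H) = -c`
(`G = M L⁻ᵀ` as in `exists_intMatrix_vecMul_eq_smul`, `H = C L⁻¹` with `C A B = ∑_{E ∈ 𝒜 \\ 𝒜, E ∩ A = ∅ = E ∩ B} μ E`).  In particular a
non-zero dependency forces `t ≠ 0`, and `-t⁻¹` is an eigenvalue of the integer matrix `H`. -/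
theorem exists_intMatrix_pair_vecMul (𝒜 : Finset (Finset α)) :
    ∃ G H : Matrix 𝒜 𝒜 ℤ, ∀ (K : Type u) [Field K] (t : K) (c : ↥𝒜 → K),
      (∑ A : 𝒜, c A • (fun E : (𝒜 \\ 𝒜 : Finset (Finset α)) =>
        (if (E : Finset α) ⊆ (A : Finset α) then (1 : K) else 0) +
          t * (if Disjoint (E : Finset α) (A : Finset α) then (1 : K) else 0))) = 0 →
      c ᵥ* G.map (Int.castRingHom K) = (-t) • c ∧ t • (c ᵥ* H.map (Int.castRingHom K)) = -c := by
  classical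
  set T : Finset (Finset α) := 𝒜 \\ 𝒜 with hTdef
  have hT : ∀ A ∈ 𝒜, ∀ B ∈ 𝒜, A \ B ∈ T := fun A hA B hB => mem_diffs.mpr ⟨A, hA, B, hB, rfl⟩
  obtain ⟨μ, hμ⟩ := moebius_weights_int' T
  let κ : Finset α → ℤ := fun Y => ∑ E ∈ T.filter (· ⊆ Y), μ E
  have hκ : ∀ A ∈ 𝒜, ∀ B ∈ 𝒜, κ (A \ B) = if A ⊆ B then 1 else 0 := by
    intro A hA B hB
    show ∑ E ∈ T.filter (· ⊆ A \ B), μ E = _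
    rw [hμ _ (hT A hA B hB)]
    simp [sdiff_eq_empty_iff_subset]
  let L : Matrix 𝒜 𝒜 ℤ := Matrix.of fun A B => if (A : Finset α) ⊆ (B : Finset α) then (1 : ℤ) else 0
  let M : Matrix 𝒜 𝒜 ℤ := Matrix.of fun A B => κ ((A : Finset α) ∩ (B : Finset α))
  let C : Matrix 𝒜 𝒜 ℤ := Matrix.of fun A B =>
    ∑ E ∈ T.filter (fun E => Disjoint E (A : Finset α) ∧ Disjoint E (B : Finset α)), μ E
  have hLap : ∀ A B : 𝒜, L A B = if (A : Finset α) ⊆ (B : Finset α) then (1 : ℤ) else 0 := fun A B => rfl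
  have hMap : ∀ A B : 𝒜, M A B = κ ((A : Finset α) ∩ (B : Finset α)) := fun A B => rfl
  have hCap : ∀ A B : 𝒜, C A B =
      ∑ E ∈ T.filter (fun E => Disjoint E (A : Finset α) ∧ Disjoint E (B : Finset α)), μ E := fun A B => rfl
  have hdetL : L.det = 1 := det_subsetMatrix_eq_one' 𝒜
  have hUL : IsUnit L.det := by rw [hdetL]; exact isUnit_one
  have hULT : IsUnit L.transpose.det := by rw [det_transpose, hdetL]; exact isUnit_one
  refine ⟨M * (L.transpose)⁻¹, C * L⁻¹, ?_⟩
  intro K _ t c hc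
  let f : ℤ →+* K := Int.castRingHom K
  have hdep : ∀ E : T, ∑ A : 𝒜, c A * ((if (E : Finset α) ⊆ (A : Finset α) then (1 : K) else 0) +
      t * (if Disjoint (E : Finset α) (A : Finset α) then (1 : K) else 0)) = 0 := by
    intro E
    have := congr_fun hc E
    simpa [Finset.sum_apply, Pi.smul_apply, smul_eq_mul] using this
  have hfilt : ∀ (p : Finset α → Prop) [DecidablePred p] (g : Finset α → K),
      ∑ E ∈ T.filter p, g E = ∑ E : T, if p E then g E else 0 := by
    intro p _ g
    rw [sum_filter, ← Finset.sum_coe_sort T]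
  have htest : ∀ w : Finset α → ℤ,
      ∑ A : 𝒜, c A * ((∑ E ∈ T.filter (· ⊆ (A : Finset α)), ((μ E * w E : ℤ) : K)) +
        t * ∑ E ∈ T.filter (fun E => Disjoint E (A : Finset α)), ((μ E * w E : ℤ) : K)) = 0 := by
    intro w
    have hA : ∀ A : 𝒜, (∑ E ∈ T.filter (· ⊆ (A : Finset α)), ((μ E * w E : ℤ) : K)) +
        t * ∑ E ∈ T.filter (fun E => Disjoint E (A : Finset α)), ((μ E * w E : ℤ) : K) =
        ∑ E : T, ((μ E * w E : ℤ) : K) * ((if (E : Finset α) ⊆ (A : Finset α) then (1 : K) else 0) +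
          t * (if Disjoint (E : Finset α) (A : Finset α) then (1 : K) else 0)) := by
      intro A
      rw [hfilt, hfilt, mul_sum, ← sum_add_distrib]
      refine sum_congr rfl fun E _ => ?_
      by_cases h1 : (E : Finset α) ⊆ (A : Finset α) <;>
        by_cases h2 : Disjoint (E : Finset α) (A : Finset α) <;> simp [h1, h2] <;> ring
    simp_rw [hA, mul_sum]
    rw [sum_comm]
    refine sum_eq_zero fun E _ => ?_
    have h3 : ∑ A : 𝒜, c A * (((μ E * w E : ℤ) : K) * ((if (E : Finset α) ⊆ (A : Finset α) then (1 : K) else 0) +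
        t * (if Disjoint (E : Finset α) (A : Finset α) then (1 : K) else 0))) =
        ((μ E * w E : ℤ) : K) * ∑ A : 𝒜, c A * ((if (E : Finset α) ⊆ (A : Finset α) then (1 : K) else 0) +
          t * (if Disjoint (E : Finset α) (A : Finset α) then (1 : K) else 0)) := by
      rw [mul_sum]
      refine sum_congr rfl fun A _ => ?_
      ring
    rw [h3, hdep E, mul_zero]
  -- entry identities
  have eL : ∀ A B : 𝒜, ∑ E ∈ T.filter (· ⊆ (A : Finset α)),
      ((μ E * (if Disjoint E (B : Finset α) then (1 : ℤ) else 0) : ℤ) : K) = ((L A B : ℤ) : K) := by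
    intro A B
    rw [hLap, ← hκ _ A.2 _ B.2]
    show _ = ((∑ E ∈ T.filter (· ⊆ (A : Finset α) \ (B : Finset α)), μ E : ℤ) : K)
    push_cast
    rw [sum_filter, sum_filter]
    refine sum_congr rfl fun E _ => ?_
    by_cases h1 : E ⊆ (A : Finset α) <;> by_cases h2 : Disjoint E (B : Finset α) <;>
      simp [h1, h2, subset_sdiff]
  have eC : ∀ A B : 𝒜, ∑ E ∈ T.filter (fun E => Disjoint E (A : Finset α)),
      ((μ E * (if Disjoint E (B : Finset α) then (1 : ℤ) else 0) : ℤ) : K) = ((C A B : ℤ) : K) := by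
    intro A B
    rw [hCap]
    push_cast
    rw [sum_filter, sum_filter]
    refine sum_congr rfl fun E _ => ?_
    by_cases h1 : Disjoint E (A : Finset α) <;> by_cases h2 : Disjoint E (B : Finset α) <;> simp [h1, h2]
  have eM : ∀ A B : 𝒜, ∑ E ∈ T.filter (· ⊆ (A : Finset α)),
      ((μ E * (if E ⊆ (B : Finset α) then (1 : ℤ) else 0) : ℤ) : K) = ((M A B : ℤ) : K) := by
    intro A B
    rw [hMap]
    show _ = ((∑ E ∈ T.filter (· ⊆ (A : Finset α) ∩ (B : Finset α)), μ E : ℤ) : K)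
    push_cast
    rw [sum_filter, sum_filter]
    refine sum_congr rfl fun E _ => ?_
    by_cases h1 : E ⊆ (A : Finset α) <;> by_cases h2 : E ⊆ (B : Finset α) <;>
      simp [h1, h2, subset_inter_iff]
  have eLt : ∀ A B : 𝒜, ∑ E ∈ T.filter (fun E => Disjoint E (A : Finset α)),
      ((μ E * (if E ⊆ (B : Finset α) then (1 : ℤ) else 0) : ℤ) : K) = ((L B A : ℤ) : K) := by
    intro A B
    rw [hLap, ← hκ _ B.2 _ A.2]
    show _ = ((∑ E ∈ T.filter (· ⊆ (B : Finset α) \ (A : Finset α)), μ E : ℤ) : K)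
    push_cast
    rw [sum_filter, sum_filter]
    refine sum_congr rfl fun E _ => ?_
    by_cases h1 : Disjoint E (A : Finset α) <;> by_cases h2 : E ⊆ (B : Finset α) <;>
      simp [h1, h2, subset_sdiff]
  have eq1 : ∀ B : 𝒜, ∑ A : 𝒜, c A * (((L A B : ℤ) : K) + t * ((C A B : ℤ) : K)) = 0 := by
    intro B
    have h := htest (fun E => if Disjoint E (B : Finset α) then 1 else 0)
    rw [← h]
    refine sum_congr rfl fun A _ => ?_
    rw [eL A B, eC A B]
  have eq2 : ∀ B : 𝒜, ∑ A : 𝒜, c A * (((M A B : ℤ) : K) + t * ((L B A : ℤ) : K)) = 0 := by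
    intro B
    have h := htest (fun E => if E ⊆ (B : Finset α) then 1 else 0)
    rw [← h]
    refine sum_congr rfl fun A _ => ?_
    rw [eM A B, eLt A B]
  have eq1m : c ᵥ* L.map f = -t • (c ᵥ* C.map f) := by
    ext B
    have h := eq1 B
    simp only [Matrix.vecMul, dotProduct, Matrix.map_apply, Pi.smul_apply, smul_eq_mul, f,
      eq_intCast] at h ⊢
    have h' : ∑ A, c A * ((L A B : ℤ) : K) + t * ∑ A, c A * ((C A B : ℤ) : K) = 0 := by
      rw [mul_sum, ← sum_add_distrib, ← h]
      refine sum_congr rfl fun A _ => ?_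
      ring
    linear_combination h'
  have eq2m : c ᵥ* M.map f = -t • (c ᵥ* (L.transpose).map f) := by
    ext B
    have h := eq2 B
    simp only [Matrix.vecMul, dotProduct, Matrix.map_apply, Matrix.transpose_apply, Pi.smul_apply,
      smul_eq_mul, f, eq_intCast] at h ⊢
    have h' : ∑ A, c A * ((M A B : ℤ) : K) + t * ∑ A, c A * ((L B A : ℤ) : K) = 0 := by
      rw [mul_sum, ← sum_add_distrib, ← h]
      refine sum_congr rfl fun A _ => ?_
      ring
    linear_combination h'
  constructor
  · rw [Matrix.map_mul, ← Matrix.vecMul_vecMul, eq2m, Matrix.smul_vecMul, Matrix.vecMul_vecMul,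
      ← Matrix.map_mul, Matrix.mul_nonsing_inv _ hULT]
    simp
  · -- from `c L = -t (c C)`:  `t • (c C L⁻¹) = -(c L L⁻¹) = -c`
    have e : t • (c ᵥ* C.map f) = -(c ᵥ* L.map f) := by
      rw [eq1m, neg_smul, neg_neg]
    calc t • (c ᵥ* (C * L⁻¹).map f)
        = t • ((c ᵥ* C.map f) ᵥ* L⁻¹.map f) := by rw [Matrix.map_mul, ← Matrix.vecMul_vecMul]
      _ = (t • (c ᵥ* C.map f)) ᵥ* L⁻¹.map f := by rw [Matrix.smul_vecMul]
      _ = (-(c ᵥ* L.map f)) ᵥ* L⁻¹.map f := by rw [e]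
      _ = -(c ᵥ* (L * L⁻¹).map f) := by rw [Matrix.neg_vecMul, Matrix.map_mul, ← Matrix.vecMul_vecMul]
      _ = -c := by rw [Matrix.mul_nonsing_inv _ hUL]; simp

end OrderedDifferences

end Summit.CriticalPhenomena.PercolationContinuityZ3.Theorems
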